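import Summits.CriticalPhenomena.PercolationContinuityZ3.Theorems.PercNearOneGluingNoHeavyQuantCatHullStep
import HarnessLib

/-!
# QUANT lane R8, T-DEC: CLOSURE PROPERTIES OF THE GATED CATERPILLAR HULL — floor lowering, top raising, blob slices, finite
# mixtures, and "closure under independent joins reduces to pairs of COLUMNS" (`InGatedCatHull.lconv_of_pairs`)

builds on p205010 (kernel theorem, internal audit signed; external expert review pending)

Support file (`--supports stmt-CriticalPhenomena-4575`), QUANT lane lead seat prim-quant-lead (gen 47), rung R8 of
`run/shared/lean/prim/quant/LADDER.md`; README V430 (the gated caterpillar hull FH of census-2 g74 as the candidate successor object;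
typer g41's `…QuantGatedCatHull` ✓ p418312 / `…QuantCatHullStep` ✓ p418864 supply `CatBuilt`, `InGatedCatHull`, `sdec_of_inGatedCatHull`,
`InGatedCatHull.mono`, `InGatedCatHull.mixture`, the node `CatHullStep`).  Theorems only (no
definition, no conjecture), standard axioms, no sorries.

WHY.  Whatever form the successor node finally takes (README V430 (1) CAT-HULL(light): "every tree-built law at a light floor is a
member", or (2) the per-outer-gate residual programme with caterpillar columns), membership certificates are ASSEMBLED from columns by
the same four moves, and an inductive proof of (1) along the tree structure needs exactly them: (i) lowering the floor
(`InGatedCatHull.mono`, typer g41 ✓ p418864) and raising the top (`InGatedCatHull.mono_top`); (ii) hanging one more independent heavy blob beside a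
member — the hull is closed under the blob SLICE (`inGatedCatHull_slice`: the column `gate Pᵢ sᵢ` sliced is again a caterpillar at the
floor, `CatBuilt.gate` then `CatBuilt.slice`; the slice is linear, `slice_mixture` of `…QuantSliceClosedAllLayers`); with typer g41's `inGatedCatHull_gate` this gives
closure under the whole tree-building step "join blobs, hang under a gate, lower the floor"; (iii) finite mixtures of members at a common
floor / mean / top are members (`InGatedCatHull.mixture`, typer g41 ✓ p418864); (iv) **closure under independent joins (convolution) of
two members REDUCES to pairs of columns** (`InGatedCatHull.lconv_of_pairs`): by bilinearity of `lconv` over the two mixtures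
(`lconv_fsum_left/right`, top truncation `lconv_top_right_of_le`) the product of two members is the `(wᵢ·vⱼ)`-mixture of the products of
their columns, so if every product of two COLUMNS `gate P s ∗ gate Q t` (caterpillars `P`, `Q` at floors `y/s`, `y/t`) is a member at the
summed mean, so is the product of the members.  Consequently CAT-HULL at a floor `y` is equivalent to the PAIR LEMMA at `y` (census-2 g74
FREEHULL-G74 §5) plus the step closure — the lead's structural remark LEAD-NOTES-G47 A2; the pair lemma itself is NOT asserted here (it is
under adversarial census, README V430; it is known to FAIL at heavy floors `y ≥ .54` on the gapped family `(R¹[q](R³[3/5]))³`).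

* `InGatedCatHull.mono_top` (`M ≤ M′`).
* **`inGatedCatHull_slice`** — `μ ∈ FH(y, T, M)`, `y ≤ g ≤ 1` ⟹ `slice μ a g ∈ FH(y, T + a·g, M + a)`.
* **`InGatedCatHull.lconv_of_pairs`** — pair lemma for columns at floor `y` (as a hypothesis) ⟹ `μ ∈ FH(y,T₁,M₁)`, `ν ∈ FH(y,T₂,M₂)` ⟹
  `μ ∗ ν ∈ FH(y, T₁+T₂, M₁+M₂)`.

HONEST STATUS: certificate-family infrastructure; `SiblingStep` / `GateStepN` / `FarTreeRow` OPEN; RATE class log\* / honest sentence of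
`run/shared/lean/prim/quant/README.md` unchanged.  [this work]; hull and caterpillars: prim-quant-census-2 g74 (certificates), prim-quant-stmt
g41 (kernel); gated blob hull: prim-quant-census-1 g23.  Nothing here is cited as a published result.  The gluing rows served
[cite: KozmaNitzan2024, Conjecture 3 (p. 15)]; product measure [cite: Grimmett1999, §1.3 p. 10].
-/

noncomputable section

open scoped BigOperators

namespace Summit.CriticalPhenomena.PercolationContinuityZ3.Theorems
namespace Quant
namespace LawDec

open Finset

/-! ### Floor and top -/

/-- **raising the top** of a membership certificate. [this work] -/
theorem InGatedCatHull.mono_top {y T : ℝ} {M M' : ℕ} {μ : ℕ → ℝ} (h : InGatedCatHull y T M μ) (hMM : M ≤ M') :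
    InGatedCatHull y T M' μ := by
  obtain ⟨ι, hι, w, s, N, P, hw0, hw1, hs, hC, hNM, hmean, hmix⟩ := h
  exact ⟨ι, hι, w, s, N, P, hw0, hw1, hs, hC, fun i => (hNM i).trans hMM, hmean, hmix⟩

/-! ### Closure under the blob slice -/

/-- **THE HULL IS CLOSED UNDER THE BLOB SLICE**: if `μ ∈ FH(y, T, M)` (`0 < y`) and `(a, g)` is a heavy blob at the floor (`y ≤ g ≤ 1`),
then `slice μ a g ∈ FH(y, T + a·g, M + a)` — each column `gate Pᵢ sᵢ` sliced is an (ungated) caterpillar at floor `y` (`CatBuilt.gate`,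
`CatBuilt.slice`) of mean `T + a·g` (`sum_mul_slice`, `sum_mul_gate`), and the slice is linear (`slice_mixture`).  With `inGatedCatHull_gate`
and `InGatedCatHull.mono` this is closure under the whole tree-building step (join blobs, hang under a gate, lower the floor). [this work] -/
theorem inGatedCatHull_slice {y T : ℝ} {M : ℕ} {μ : ℕ → ℝ} (h : InGatedCatHull y T M μ) (hy0 : 0 < y) (a : ℕ) (g : ℝ)
    (hyg : y ≤ g) (hg1 : g ≤ 1) : InGatedCatHull y (T + (a : ℝ) * g) (M + a) (slice μ a g) := by
  obtain ⟨ι, hι, w, s, N, P, hw0, hw1, hs, hC, hNM, hmean, hmix⟩ := h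
  refine ⟨ι, hι, w, fun _ => 1, fun i => N i + a, fun i => slice (gate (P i) (s i)) a g, hw0, hw1,
    fun i => ⟨lt_of_lt_of_le (hs i).1 (hs i).2, le_rfl⟩, fun i => ?_, fun i => Nat.add_le_add_right (hNM i) a, fun i => ?_, fun k => ?_⟩
  · rw [div_one]
    have hs0 : 0 < s i := hy0.trans (hs i).1
    have hg := (hC i).gate (s i) hs0 (hs i).2
    rw [mul_div_cancel₀ y hs0.ne'] at hg
    exact hg.slice a g hyg hg1
  · obtain ⟨p0, pM, p1, _⟩ := (hC i).lawFacts
    have hs0' : 0 ≤ s i := hy0.le.trans (hs i).1.le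
    obtain ⟨_, gM, g1⟩ := gate_laws (N i) (P i) (s i) hs0' (hs i).2 p0 pM p1
    rw [one_mul, sum_mul_slice (gate (P i) (s i)) a g (N i) gM g1, sum_mul_gate, hmean i]
  · have eμ : μ = fun t => ∑ i, w i * gate (P i) (s i) t := funext hmix
    rw [eμ, slice_mixture w (fun i => gate (P i) (s i)) a g k]
    exact Finset.sum_congr rfl fun i _ => by rw [gate_one]

/-! ### Closure under independent joins reduces to pairs of columns -/

/-- **CLOSURE OF THE HULL UNDER CONVOLUTION REDUCES TO PAIRS OF COLUMNS.**  Suppose (the PAIR LEMMA at floor `y`, as a hypothesis) that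
for all caterpillar columns `gate P s`, `gate Q t` at floor `y` (`y < s, t ≤ 1`, `CatBuilt (y/s) N₁ P`, `CatBuilt (y/t) N₂ Q`) the product
`lconv N₁ N₂ (gate P s) (gate Q t)` lies in `FH(y, s·mean P + t·mean Q, N₁ + N₂)`.  Then for members `μ ∈ FH(y, T₁, M₁)`, `ν ∈ FH(y, T₂, M₂)`
the independent join `lconv M₁ M₂ μ ν` lies in `FH(y, T₁ + T₂, M₁ + M₂)`: `lconv` is bilinear over the two mixtures (`lconv_fsum_left`,
`lconv_fsum_right`), the declared tops may be lowered to the columns' tops (`lconv_top_right_of_le`, `lconv_comm`), each column product is a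
member by hypothesis (raised to the common top, `mono_top`), and the `(wᵢ·vⱼ)`-mixture of members is a member (`InGatedCatHull.mixture`). [this work] -/
theorem InGatedCatHull.lconv_of_pairs {y T₁ T₂ : ℝ} {M₁ M₂ : ℕ} {μ ν : ℕ → ℝ}
    (hpair : ∀ (s t : ℝ) (N₁ N₂ : ℕ) (P Q : ℕ → ℝ), y < s → s ≤ 1 → y < t → t ≤ 1 →
      CatBuilt (y / s) N₁ P → CatBuilt (y / t) N₂ Q →
      InGatedCatHull y (s * (∑ h ∈ Finset.range (N₁ + 1), (h : ℝ) * P h) + t * (∑ h ∈ Finset.range (N₂ + 1), (h : ℝ) * Q h))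
        (N₁ + N₂) (lconv N₁ N₂ (gate P s) (gate Q t)))
    (hy0 : 0 < y) (hμ : InGatedCatHull y T₁ M₁ μ) (hν : InGatedCatHull y T₂ M₂ ν) :
    InGatedCatHull y (T₁ + T₂) (M₁ + M₂) (lconv M₁ M₂ μ ν) := by
  classical
  obtain ⟨ι, hι, w, s, N, P, hw0, hw1, hs, hC, hNM, hmean, hmix⟩ := hμ
  obtain ⟨κ, hκ, v, t, N', Q, hv0, hv1, ht, hD, hNM', hmean', hmix'⟩ := hν
  -- the column laws vanish above their tops
  have gPM : ∀ i k, N i < k → gate (P i) (s i) k = 0 := fun i => by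
    obtain ⟨p0, pM, p1, _⟩ := (hC i).lawFacts
    exact (gate_laws (N i) (P i) (s i) (hy0.le.trans (hs i).1.le) (hs i).2 p0 pM p1).2.1
  have gQM : ∀ j k, N' j < k → gate (Q j) (t j) k = 0 := fun j => by
    obtain ⟨q0, qM, q1, _⟩ := (hD j).lawFacts
    exact (gate_laws (N' j) (Q j) (t j) (hy0.le.trans (ht j).1.le) (ht j).2 q0 qM q1).2.1
  -- bilinearity: the product of the mixtures is the mixture of the column products
  have e : ∀ h, lconv M₁ M₂ μ ν h =
      ∑ p : ι × κ, (w p.1 * v p.2) * lconv (N p.1) (N' p.2) (gate (P p.1) (s p.1)) (gate (Q p.2) (t p.2)) h := by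
    intro h
    have eμ : μ = fun k => ∑ i, w i * gate (P i) (s i) k := funext hmix
    have eν : ν = fun k => ∑ j, v j * gate (Q j) (t j) k := funext hmix'
    rw [eμ, eν, lconv_fsum_left, Fintype.sum_prod_type]
    refine Finset.sum_congr rfl fun i _ => ?_
    rw [lconv_fsum_right, Finset.mul_sum]
    refine Finset.sum_congr rfl fun j _ => ?_
    rw [lconv_top_right_of_le M₁ (N' j) M₂ _ _ (hNM' j) (gQM j), lconv_comm,
      lconv_top_right_of_le (N' j) (N i) M₁ _ _ (hNM i) (gPM i), lconv_comm]
    ring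
  -- every column product is a member at the common data
  have hmem : ∀ p : ι × κ, InGatedCatHull y (T₁ + T₂) (M₁ + M₂)
      (lconv (N p.1) (N' p.2) (gate (P p.1) (s p.1)) (gate (Q p.2) (t p.2))) := fun p => by
    have := hpair (s p.1) (t p.2) (N p.1) (N' p.2) (P p.1) (Q p.2) (hs p.1).1 (hs p.1).2 (ht p.2).1 (ht p.2).2 (hC p.1) (hD p.2)
    rw [hmean p.1, hmean' p.2] at this
    exact this.mono_top (Nat.add_le_add (hNM p.1) (hNM' p.2))
  refine InGatedCatHull.mixture (fun p : ι × κ => w p.1 * v p.2) _ (fun p => mul_nonneg (hw0 p.1) (hv0 p.2)) ?_ hmem _ e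
  rw [Fintype.sum_prod_type]
  have e2 : ∀ i, ∑ j, w i * v j = w i := fun i => by rw [← Finset.mul_sum, hv1, mul_one]
  simp_rw [e2]
  exact hw1

end LawDec
end Quant
end Summit.CriticalPhenomena.PercolationContinuityZ3.Theorems
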